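import Literature.MathematicalPhysics.QuantumFieldTheory.Balaban1983to89.T4PrintedShapeBanking
import Literature.MathematicalPhysics.QuantumFieldTheory.Balaban1983to89.T4LiveGasToTerms

/-!
# `Balaban1983to89.T4RecordPriceSeam` — THE SEAM, BY NAME: the printed-shape price side
(`T4PrintedShapeBanking`: typed flow ⇒ ONE infrared threshold ⇒ `Banking` ⇒ `printedShape_recordPrice`) composed with
the count carrier's records gas (`T4LiveStructureGas.exists_relWeightBound_of_recordsGas`, the renewal member's
term-level form `T4LiveGasToTerms.exists_relWeightBound_of_regeneration_recordsGas`) into ONE kernel statement whose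
hypotheses are exactly the cell's named conditionals (cell `pub-balaban`, T4-DAG §5 self-row T4-U5c.E-NE7b-SEAM-K*
(§8 Q24(a)), node U5c / U5.E, spine estimate NE7b, COUNT member P1 gen 11; kernel bookkeeping — finite combinatorics +
real arithmetic; imports `T4PrintedShapeBanking` (this lineage, v1.2 p190862) and `T4LiveGasToTerms` (renewal member
t4-ne7b-p2, v1.1; it imports `T4LiveStructureGas` + `T4LiveClassFibration`) BY NAME and modifies nothing)

HONEST FRAMING (T4-DAG PAGE 1).  The cell's T4 target is the existence and uniqueness of the `ε → 0` limit of unit-scale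
block-averaged expectations on a FIXED finite torus, at rung (B)+1, CONDITIONAL on Bałaban's ultraviolet stability (B)
and on BetaPertH; it is NOT infinite volume, NOT the mass gap, NOT the Clay problem.  This module is [folklore] finite
combinatorics and real analysis.  NOTHING of Bałaban's is asserted: no sentence of [Balaban1989LargeFieldII] (cell paper
B16, CMP 122 (1989) 355–392) or of [Balaban1988Convergent] (B14, CMP 119 (1988) 243–285) is quoted or typed here (the
typed displays (2.5) `B14.IsRj`, (2.7) `B14.FlowIneq27`, (2.9) `B14FlowStep.FlowIneq29` enter as HYPOTHESES, by name,
exactly as in `T4PrintedShapeBanking.exists_irThreshold`).  Every conditional of the chain is a DISPLAYED binder of the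
theorems below — none is hidden in a definition: the typed flow along each run, the infrared smallness of each run's
last coupling, the LABELLING of live-slot prices by consistent well-formed genealogies (= the cell's located-unprinted
READING (ID-a)/(ID-b)/(ID-c) + R3′, GAPS G-ne7bp1g9-1, owner O-R10 / pv25 / pv22 under RULING R-GD-1 — NOT discharged
here, NOT citable, displayed), the cell geometry `#Cell K a ≤ V·Λ^a`, the two residual budgets `ρ̄`, `η̄` with the rate
`Λ·e^{η̄ − κ₁} < 1`, the matching scale `j⋆`, the injective live families with an old slot, the two term-level runs in
the regeneration reading (`T4LiveClassFibration.Regeneration`: (G2), (R3′), (RS), (G5) — the renewal member's hypothesis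
SHAPE, NOT asserted) and the domination of their resummed live prices by the live-family record weights.  BetaPertH, (B),
(B^μ) appear in no definition of this module; where the flow hypotheses come from ((B) + BetaPertH through `Setup.Flow`
and the β-function bounds, `B14FlowStep`) is the business of the seats owning those nodes.  Value = a kernel certificate
that the count member's chain is CLOSED END-TO-END BY NAME — before this module the price side (`exists_irThreshold`,
`banking_printedShape_of_flow`, `printedShape_recordPrice`) had no consumer in the tree and met the records-gas binder
`hy` only in prose (the docstring phrase 'the EXACT shape of … `hy`' of `T4BankedInduction.rawFactor_le_recordPrice`); NOT an estimate of
Bałaban's expansion; NOT a proof of NE7b; NOT summit progress.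

THE POINT.  `T4LiveStructureGas.exists_relWeightBound_of_recordsGas` asks, per cutoff `K` and live slot
`(j, z, b, Q)` (birth step, birth cell, birth kind, record), for a price `0 ≤ y K j z b Q` under the ABSOLUTE majorant
  `hy`:  `y K j z b Q ≤ ρ b · e^{−κ₁ W b} · ∏_{e ∈ Q} (e^{−κ₁ W e} · η e)`.
`T4PrintedShapeBanking.printedShape_recordPrice` delivers, per CONSISTENT WELL-FORMED GENEALOGY `G` of the dictionary
(`T4PersistenceDictionary.Gen PEv`, window table `dictW R n₁`), once the printed shapes inhabit `Banking`,
  `e^{−credits G} · e^{+lifeCost G} ≤ ρ_root · e^{−κ₁ W root} · ∏_{e ∈ events ∖ root} (e^{−κ₁ W e} · η e)`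
with `ρ b = e^{−(reserve b + Emarg b)}` (`= e^{−(2p₀(g_j) + Eb + μ(d′+1))}` at the root birth, `root_price`) and
`η e = e^{−Emarg e}`.  The two index sets differ — slots `(j, z, b, Q)` versus genealogies `G` — and the junction is the
(ID) reading: the realised price of a live slot is carried by SOME consistent well-formed genealogy with that root and
that record.  This module TYPES the junction as a displayed binder and composes:
  §1 THE PER-CUTOFF SEAM.  `rho C g b := e^{−(reserve C g b + Emarg C b)}`, `eta C e := e^{−Emarg C e}` (positive);
     `price_le_shape`: `Banking (Consistent C K R) (dictW R C.n₁) (cost C K R) (credit C g) (κ₁·W + Emarg) (reserve C g)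
     (extn C K R)` and a price `y` LABELLED at `(b, Q)` — `y ≤ 0 ∨ ∃ G, Consistent C K R G ∧ G.WF (dictW R C.n₁) ∧
     G.root = b ∧ G.events.erase G.root = Q ∧ y ≤ e^{−credits (credit C g) G}·e^{+lifeCost (dictW R C.n₁) (cost C K R) G}`
     — ⇒ `y ≤ rho C g b · e^{−κ₁ W b} · ∏_{e ∈ Q} (e^{−κ₁ W e} · eta C e)` (`printedShape_recordPrice` by name; the
     unlabelled branch `y ≤ 0` is below the positive shape); `recordShape_of_banking`: the same over all live slots of
     the cutoff = the binder `hy K` of the records gas with `ρ := rho C g`, `η := eta C`, `W := dictW R C.n₁`,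
     `κ₁ := C.κ₁`.  (The record of a pending well-formed genealogy IS a record of the count: `Gen.mem_records`.)
  §2 THE RECORDS GAS INDEXED BY THE RUN.  Along the continuum limit the run `(g_s, R_s)_{s ≤ K}` — hence the window
     table `dictW (R K) n₁`, the birth residual `rho C (g K)` — depends on the cutoff `K`, while the budgets `ρ̄`, `η̄`,
     `κ₁`, `V`, `Λ` do not.  `exists_relWeightBound_of_recordsGasRun` is `T4LiveStructureGas.exists_relWeightBound_of_
     recordsGas` with `W K`, `ρ K`, `η K` per cutoff and the majorant `hy` asked only from the threshold `K₀` on — the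
     SAME proof (`liveMass_le` / `oldMass_le` are per cutoff; `exists_relWeightBound_of_liveGas` uses the masses only for
     `K ≥ K₀`); `exists_relWeightBound_of_regeneration_recordsGasRun` is its term-level form through the renewal member's
     `Regeneration.globalDom` ×2 and `relWeightBound_of_classes` (as `T4LiveGasToTerms` §4).
  §3 END TO END.  `exists_relWeightBound_of_banking`: `Banking` at every cutoff `K ≥ K₀` of a family of runs
     `(R K, g K)` + cell geometry + residual budgets for `rho C (g K)` / `eta C` + labelled prices (`K ≥ K₀`) + nonnegative
     prices + injective live families with an old slot + two `Regeneration` runs dominated by `famWeight (slotPrice (y K))`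
     ⇒ `∃ K₁ ≥ K₀, RelWeightBound` (term level, saturated bad set, `W = 𝟙_{K ≥ K₁}·Cn·recordsBudget ρ̄ C.κ₁ V Λ η̄ j⋆`);
     `exists_irThreshold_relWeightBound`: with `T4PrintedShapeBanking.exists_irThreshold` — for valid symbolic constants
     with `a, A₀ > 0`, `L ≥ 1`, `β₀ ≥ 0`, `r(q′+1) < p₀` there is ONE number `x₀` (constants only) such that for EVERY family
     of runs `(R K, g K, β′ K)_K` obeying typed (2.7), (2.9), (2.5), `1 ≤ log g_{K,s}⁻²` and the infrared smallness
     `x₀ ≤ log g_{K,K}⁻²` from `K₀` on, the rest of the data as in `exists_relWeightBound_of_banking` gives the kernel's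
     `RelWeightBound`.  THIS is the count member's chain as ONE statement; its binders are the census of what is not
     kernel: typed flow + infrared smallness (node owners of (B)/BetaPertH/`Setup.Flow`), the labelling ((ID), G-ne7bp1g9-1),
     `Regeneration` ×2 + domination ((G2)/(G3)/(G5), renewal member / E2-rel owners), the residual budgets and the live
     families (entropy seats; see the REMARK in §4 on the event universe), the cell geometry (R4).
  §4 SANITY.  The labelling data are inhabited by the cross-read's genealogies of `T4PrintedShapeBanking.XreadC4` (a bare
     birth: record `∅`; the merged history `Z₀`: root `(0,0,0)`, record `{(2,0,0), (3,2,0)}` — decided); `rho`/`eta` on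
     the three kinds.  REMARK (event universe): `eta C e = e^{−E₀}` on renewals and mergers WHATEVER the dummy fatness
     coordinate of `e`, so the per-step residual budget `η̄` is `K`-uniform only over event universes that do not multiply
     kind-1/kind-2 events by a `K`-dependent fatness range (e.g. `dictE` restricted to `kind ≠ 0 → fat = 0`); the
     universes `E`, `B` stay ABSTRACT binders here, as in the records gas.
WHAT THIS DOES NOT DO: it does not discharge the labelling (the READING (ID-a)/(ID-b)/(ID-c) + R3′), the typed flow or the
infrared smallness, `Regeneration` or the domination `hF`, the budgets or the live families; it does not touch (G2)/(G5);
the wall G-ne7bp1-1 (relocated under (GD) as (G3) = R1 + R3′ + (ID), RULING R-GD-1) is neither narrowed nor widened.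

References (locators only, nothing quoted): [Balaban1989LargeFieldII] (1.79) p. 383, (1.82) p. 385, (1.84)–(1.89)
pp. 385–388; [Balaban1988Convergent] (2.5), (2.7) p. 255, (2.9) p. 256 — as typed in `B14` / `B14FlowStep` and read in
`T4PrintedShapeBanking` / `T4PersistenceDictionary` / `T4LiveStructureGas`.
-/

open Finset

namespace Literature.MathematicalPhysics.QuantumFieldTheory.Balaban1983to89.T4RecordPriceSeam

open Literature.MathematicalPhysics.QuantumFieldTheory.Balaban1983to89
open T4PersistenceDictionary T4PersistentHistoryCount T4BankedInduction T4PrintedShapeBanking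
open T4WeightBudget T4GlobalDenominator T4LiveClassFibration T4LiveStructureGas

/-! ## §1 The per-cutoff seam: labelled prices obey the carrier's shape -/

section Seam

/-- **THE BIRTH RESIDUAL** of the model in the count's currency: `ρ b = e^{−(reserve b + Emarg b)}` — at a birth of class
`d′` at step `j`, `e^{−(2p₀(g_j) + Eb + μ(d′+1))}` (`T4PrintedShapeBanking.root_price`). [folklore] -/
noncomputable def rho (C : T4PrintedShapeBanking.Consts) (g : ℕ → ℝ) (b : PEv) : ℝ := Real.exp (-(reserve C g b + Emarg C b))

/-- **THE EVENT WEIGHT** of the model in the count's currency: `η e = e^{−Emarg e}` (`e^{−E₀}` at renewals and mergers,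
`e^{−(Eb + μ(d′+1))}` at births). [folklore] -/
noncomputable def eta (C : T4PrintedShapeBanking.Consts) (e : PEv) : ℝ := Real.exp (-Emarg C e)

/-- the birth residual is positive [folklore] -/
theorem rho_pos (C : T4PrintedShapeBanking.Consts) (g : ℕ → ℝ) (b : PEv) : 0 < rho C g b := Real.exp_pos _

/-- the event weight is positive [folklore] -/
theorem eta_pos (C : T4PrintedShapeBanking.Consts) (e : PEv) : 0 < eta C e := Real.exp_pos _

/-- the birth residual unfolded [folklore] -/
theorem rho_eq (C : T4PrintedShapeBanking.Consts) (g : ℕ → ℝ) (b : PEv) : rho C g b = Real.exp (-(reserve C g b + Emarg C b)) := rfl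

/-- the event weight unfolded [folklore] -/
theorem eta_eq (C : T4PrintedShapeBanking.Consts) (e : PEv) : eta C e = Real.exp (-Emarg C e) := rfl

/-- **THE SHAPE IS POSITIVE**: `ρ b · e^{−κ₁ W b} · ∏_{e ∈ Q} (e^{−κ₁ W e} · η e) > 0` for the model's `ρ`, `η` and any
window table. [folklore] -/
theorem shape_pos (C : T4PrintedShapeBanking.Consts) (g : ℕ → ℝ) (W : PEv → ℕ) (κ₁ : ℝ) (b : PEv) (Q : Finset PEv) :
    0 < rho C g b * Real.exp (-(κ₁ * W b)) * ∏ e ∈ Q, (Real.exp (-(κ₁ * W e)) * eta C e) :=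
  mul_pos (mul_pos (rho_pos C g b) (Real.exp_pos _))
    (Finset.prod_pos fun e _ => mul_pos (Real.exp_pos _) (eta_pos C e))

variable {C : T4PrintedShapeBanking.Consts} {K : ℕ} {R : ℕ → ℕ} {g : ℕ → ℝ}

/-- **THE SEAM, ONE SLOT.**  If the printed shapes inhabit `Banking` at cutoff `K` along the run `(R, g)`, then a price
`y` LABELLED at `(b, Q)` — either `y ≤ 0`, or `y` is at most the raw factor `e^{−credits}·e^{+lifeCost}` of SOME
consistent well-formed genealogy with root `b` and record `Q` (the displayed (ID) binder) — obeys the carrier's shape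
`y ≤ ρ b · e^{−κ₁ W b} · ∏_{e ∈ Q} (e^{−κ₁ W e} · η e)` with `ρ = rho C g`, `η = eta C`, `W = dictW R C.n₁`, `κ₁ = C.κ₁`.
By `T4PrintedShapeBanking.printedShape_recordPrice`. [folklore] -/
theorem price_le_shape
    (hBk : Banking (Consistent C K R) (dictW R C.n₁) (cost C K R) (credit C g)
      (fun e => C.κ₁ * ((dictW R C.n₁ e : ℕ) : ℝ) + Emarg C e) (reserve C g) (extn C K R))
    {y : ℝ} {b : PEv} {Q : Finset PEv}
    (hlab : y ≤ 0 ∨ ∃ G : Gen PEv, Consistent C K R G ∧ G.WF (dictW R C.n₁) ∧ G.root = b ∧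
      G.events.erase G.root = Q ∧
      y ≤ Real.exp (-credits (credit C g) G) * Real.exp (lifeCost (dictW R C.n₁) (cost C K R) G)) :
    y ≤ rho C g b * Real.exp (-(C.κ₁ * dictW R C.n₁ b)) *
      ∏ e ∈ Q, (Real.exp (-(C.κ₁ * dictW R C.n₁ e)) * eta C e) := by
  rcases hlab with h | ⟨G, hc, hW, hb, hQ, hy⟩
  · exact h.trans (shape_pos C g (dictW R C.n₁) C.κ₁ b Q).le
  · have hp := printedShape_recordPrice hBk hc hW
    rw [hQ, hb] at hp
    simpa only [rho_eq, eta_eq] using hy.trans hp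

/-- **THE SEAM, ONE CUTOFF** = the binder `hy K` of the records gas: prices `y j z b Q` on the live slots of cutoff `K`
(births `j ≤ K`, cells `z ∈ Cell K (K − j)`, kinds `b ∈ B K j`, records `Q ∈ records (dictW R C.n₁) j K (E K j) b`)
that are LABELLED by consistent well-formed genealogies obey the carrier's shape at every live slot. [folklore] -/
theorem recordShape_of_banking {γ : Type*}
    (hBk : Banking (Consistent C K R) (dictW R C.n₁) (cost C K R) (credit C g)
      (fun e => C.κ₁ * ((dictW R C.n₁ e : ℕ) : ℝ) + Emarg C e) (reserve C g) (extn C K R))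
    (Cell : ℕ → ℕ → Finset γ) (E B : ℕ → ℕ → Finset PEv) (y : ℕ → γ → PEv → Finset PEv → ℝ)
    (hlab : ∀ j ≤ K, ∀ z ∈ Cell K (K - j), ∀ b ∈ B K j, ∀ Q ∈ records (dictW R C.n₁) j K (E K j) b,
      y j z b Q ≤ 0 ∨ ∃ G : Gen PEv, Consistent C K R G ∧ G.WF (dictW R C.n₁) ∧ G.root = b ∧
        G.events.erase G.root = Q ∧
        y j z b Q ≤ Real.exp (-credits (credit C g) G) * Real.exp (lifeCost (dictW R C.n₁) (cost C K R) G)) :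
    ∀ j ≤ K, ∀ z ∈ Cell K (K - j), ∀ b ∈ B K j, ∀ Q ∈ records (dictW R C.n₁) j K (E K j) b,
      y j z b Q ≤ rho C g b * Real.exp (-(C.κ₁ * dictW R C.n₁ b)) *
        ∏ e ∈ Q, (Real.exp (-(C.κ₁ * dictW R C.n₁ e)) * eta C e) :=
  fun j hj z hz b hb Q hQ => price_le_shape hBk (hlab j hj z hz b hb Q hQ)

/-- **THE LABEL'S RECORD IS A RECORD OF THE COUNT** (convenience, `Gen.mem_records` by name): a well-formed genealogy
still pending at the cutoff (`K < reach`) whose non-root events lie in the universe `E` has its record in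
`records (dictW R C.n₁) rootStep K E root`. [folklore] -/
theorem label_mem_records {G : Gen PEv} (hW : G.WF (dictW R C.n₁)) (hK : K < G.reach (dictW R C.n₁))
    {E : Finset PEv} (hE : G.events.erase G.root ⊆ E) :
    G.events.erase G.root ∈ records (dictW R C.n₁) G.rootStep K E G.root :=
  Gen.mem_records hW hK hE

end Seam

/-! ## §2 The records gas indexed by the run (window table and residuals per cutoff) -/

section Run

variable {γ ε : Type*}

/-- **(G4) OVER THE LIVE INDEX SET, RUN-INDEXED, COMPOSED WITH THE EXTRACTION** —
`T4LiveStructureGas.exists_relWeightBound_of_recordsGas` with the window table `W K`, the birth residual `ρ K` and the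
event weight `η K` depending on the cutoff `K` (the run `(g_s, R_s)_{s ≤ K}` does), the budgets `ρ̄`, `η̄`, `κ₁`, `V`,
`Λ`, the cut `j⋆` uniform, and the per-record majorant `hy` asked only from the threshold `K₀` on.  Same proof:
`liveMass_le` / `oldMass_le` per cutoff, `summable_recordsBudget`, `exists_relWeightBound_of_liveGas`. [folklore] -/
theorem exists_relWeightBound_of_recordsGasRun [DecidableEq γ] [DecidableEq ε] {ι : Type*} {l₀ : ℝ} {K₀ : ℕ}
    {T : ℕ → Finset ι} {A A' : ℕ → ℝ → ι → ℝ} {Bad : ℕ → ℝ → Finset ι} {F F' : ℕ → ι → ℝ}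
    {nlow nup mlow mup : ℕ → ℝ → ℝ} {C : ℝ}
    (Cell : ℕ → ℕ → Finset γ) {V Λ : ℝ} (hV : 0 ≤ V) (hΛ : 0 < Λ)
    (hcell : ∀ K a, ((Cell K a).card : ℝ) ≤ V * Λ ^ a) (W : ℕ → ε → ℕ) (step : ε → ℕ) (E B : ℕ → ℕ → Finset ε)
    (hE : ∀ K j, ∀ e ∈ E K j, step e ∈ Ioc j K) {κ₁ ρbar ηbar : ℝ} (hκ : 0 ≤ κ₁) (ρ : ℕ → ε → ℝ)
    (hρ : ∀ K j, ∀ b ∈ B K j, 0 ≤ ρ K b) (hρbar : ∀ K j, ∑ b ∈ B K j, ρ K b ≤ ρbar) (η : ℕ → ε → ℝ)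
    (hη : ∀ K j, ∀ e ∈ E K j, 0 ≤ η K e)
    (hηbar : ∀ K j, ∀ t ∈ Ioc j K, ∑ e ∈ E K j with step e = t, η K e ≤ ηbar)
    (hr : Λ * Real.exp (ηbar - κ₁) < 1) (jstar : ℕ → ℕ) (hj : ∀ K, jstar K ≤ K) {c : ℝ} (hc : 0 < c)
    (hfrac : ∀ K : ℕ, c * K ≤ ((K - jstar K : ℕ) : ℝ)) (y : ℕ → ℕ → γ → ε → Finset ε → ℝ)
    (hy0 : ∀ K, ∀ j ≤ K, ∀ z ∈ Cell K (K - j), ∀ b ∈ B K j, ∀ Q ∈ records (W K) j K (E K j) b, 0 ≤ y K j z b Q)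
    (hy : ∀ K, K₀ ≤ K → ∀ j ≤ K, ∀ z ∈ Cell K (K - j), ∀ b ∈ B K j, ∀ Q ∈ records (W K) j K (E K j) b,
      y K j z b Q ≤ ρ K b * Real.exp (-(κ₁ * W K b)) * ∏ e ∈ Q, (Real.exp (-(κ₁ * W K e)) * η K e))
    (str : ℕ → ι → Finset (Slot γ ε))
    (hinj : ∀ K t, |t| ≤ l₀ → K₀ ≤ K → Set.InjOn (str K) (Bad K t))
    (hstr : ∀ K t, |t| ≤ l₀ → K₀ ≤ K → ∀ τ ∈ Bad K t,
      str K τ ⊆ liveSlots Cell (W K) E B K ∧ ∃ o ∈ oldSlots Cell (W K) E B jstar K, o ∈ str K τ)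
    (hA : GlobalDom l₀ T A Bad F nlow nup C K₀) (hA' : GlobalDom l₀ T A' Bad F' mlow mup C K₀)
    (hF : ∀ K t, |t| ≤ l₀ → K₀ ≤ K → ∀ τ ∈ Bad K t, F K τ ≤ famWeight (slotPrice (y K)) (str K τ))
    (hF' : ∀ K t, |t| ≤ l₀ → K₀ ≤ K → ∀ τ ∈ Bad K t, F' K τ ≤ famWeight (slotPrice (y K)) (str K τ))
    (hC : 0 ≤ C) :
    ∃ K₁, K₀ ≤ K₁ ∧ RelWeightBound l₀ T A A' (fun K t => if K₁ ≤ K then Bad K t else ∅)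
      (Set.indicator {K | K₁ ≤ K} (fun K => C * recordsBudget ρbar κ₁ V Λ ηbar jstar K)) := by
  have hρbar0 : 0 ≤ ρbar := le_trans (Finset.sum_nonneg (hρ 0 0)) (hρbar 0 0)
  -- prices are nonnegative on the live slots
  have hq : ∀ K, ∀ s ∈ liveSlots Cell (W K) E B K, 0 ≤ slotPrice (y K) s := by
    intro K s hs
    obtain ⟨j, z, b, Q⟩ := s
    simp only [liveSlots, Finset.mem_sigma, Finset.mem_range] at hs
    exact hy0 K j (Nat.lt_succ_iff.1 hs.1) z hs.2.1 b hs.2.2.1 Q hs.2.2.2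
  have hM := exists_relWeightBound_of_liveGas (fun K => liveSlots Cell (W K) E B K)
    (fun K => oldSlots Cell (W K) E B jstar K)
    (fun K => oldSlots_subset_liveSlots Cell (W K) E B (hj K)) (fun K => slotPrice (y K)) hq str hinj hstr
    (mold := fun K => ρbar * Real.exp (-κ₁) * V *
      ((Λ * Real.exp (ηbar - κ₁)) ^ (K - jstar K + 1) / (1 - Λ * Real.exp (ηbar - κ₁))))
    (mlive := fun K => ρbar * Real.exp (-κ₁) * V * (1 / (1 - Λ * Real.exp (ηbar - κ₁))))
    (fun K => ?_) (fun K hK => ?_) (fun K hK => ?_) ?_ hA hA' hF hF' hC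
  · exact hM
  · -- mold ≥ 0
    have hσ0 : 0 ≤ Λ * Real.exp (ηbar - κ₁) := mul_nonneg hΛ.le (Real.exp_pos _).le
    have h1 : 0 < 1 - Λ * Real.exp (ηbar - κ₁) := by linarith
    exact mul_nonneg (mul_nonneg (mul_nonneg hρbar0 (Real.exp_pos _).le) hV)
      (div_nonneg (pow_nonneg hσ0 _) h1.le)
  · exact oldMass_le Cell hV hΛ.le hcell (W K) step E B (hE K) hκ (ρ K) (hρ K) (hρbar K) (η K) (hη K) (hηbar K) hr
      (hj K) (y K) (hy K hK)
  · exact liveMass_le Cell hV hΛ.le hcell (W K) step E B (hE K) hκ (ρ K) (hρ K) (hρbar K) (η K) (hη K) (hηbar K) hr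
      (y K) (hy K hK)
  · exact summable_recordsBudget hρbar0 hV hΛ hr hc hfrac

/-- **… TERM LEVEL, THROUGH THE REGENERATION READING** (as `T4LiveGasToTerms.exists_relWeightBound_of_regeneration_
recordsGas`, run-indexed): two TERM-level runs `Regeneration` (renewal member) + the run-indexed records gas + domination
of the RESUMMED class prices by `famWeight (slotPrice (y K))` ⇒ `∃ K₁ ≥ K₀`, the kernel's term-level `RelWeightBound`
with the saturated bad set.  `Regeneration.globalDom` ×2, §2, `relWeightBound_of_classes`. [folklore] -/
theorem exists_relWeightBound_of_regeneration_recordsGasRun {κ ι : Type*} [DecidableEq γ] [DecidableEq ε]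
    [DecidableEq κ] {l₀ : ℝ} {K₀ : ℕ} {π : ℕ → ι → κ} {T : ℕ → Finset ι}
    {A A' : ℕ → ℝ → ι → ℝ} {Bad' : ℕ → ℝ → Finset κ} {dead dead' : ℕ → ℝ → ι → ℝ} {F Rf F' Rf' : ℕ → κ → ℝ}
    {nlow nup mlow mup : ℕ → ℝ → ℝ} {C : ℝ}
    (Cell : ℕ → ℕ → Finset γ) {V Λ : ℝ} (hV : 0 ≤ V) (hΛ : 0 < Λ)
    (hcell : ∀ K a, ((Cell K a).card : ℝ) ≤ V * Λ ^ a) (W : ℕ → ε → ℕ) (step : ε → ℕ) (E B : ℕ → ℕ → Finset ε)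
    (hE : ∀ K j, ∀ e ∈ E K j, step e ∈ Ioc j K) {κ₁ ρbar ηbar : ℝ} (hκ : 0 ≤ κ₁) (ρ : ℕ → ε → ℝ)
    (hρ : ∀ K j, ∀ b ∈ B K j, 0 ≤ ρ K b) (hρbar : ∀ K j, ∑ b ∈ B K j, ρ K b ≤ ρbar) (η : ℕ → ε → ℝ)
    (hη : ∀ K j, ∀ e ∈ E K j, 0 ≤ η K e)
    (hηbar : ∀ K j, ∀ t ∈ Ioc j K, ∑ e ∈ E K j with step e = t, η K e ≤ ηbar)
    (hr : Λ * Real.exp (ηbar - κ₁) < 1) (jstar : ℕ → ℕ) (hj : ∀ K, jstar K ≤ K) {c : ℝ} (hc : 0 < c)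
    (hfrac : ∀ K : ℕ, c * K ≤ ((K - jstar K : ℕ) : ℝ)) (y : ℕ → ℕ → γ → ε → Finset ε → ℝ)
    (hy0 : ∀ K, ∀ j ≤ K, ∀ z ∈ Cell K (K - j), ∀ b ∈ B K j, ∀ Q ∈ records (W K) j K (E K j) b, 0 ≤ y K j z b Q)
    (hy : ∀ K, K₀ ≤ K → ∀ j ≤ K, ∀ z ∈ Cell K (K - j), ∀ b ∈ B K j, ∀ Q ∈ records (W K) j K (E K j) b,
      y K j z b Q ≤ ρ K b * Real.exp (-(κ₁ * W K b)) * ∏ e ∈ Q, (Real.exp (-(κ₁ * W K e)) * η K e))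
    (str : ℕ → κ → Finset (Slot γ ε))
    (hinj : ∀ K t, |t| ≤ l₀ → K₀ ≤ K → Set.InjOn (str K) (Bad' K t))
    (hstr : ∀ K t, |t| ≤ l₀ → K₀ ≤ K → ∀ c ∈ Bad' K t,
      str K c ⊆ liveSlots Cell (W K) E B K ∧ ∃ o ∈ oldSlots Cell (W K) E B jstar K, o ∈ str K c)
    (hA : Regeneration l₀ π T A Bad' dead F Rf nlow nup C K₀)
    (hA' : Regeneration l₀ π T A' Bad' dead' F' Rf' mlow mup C K₀)
    (hF : ∀ K t, |t| ≤ l₀ → K₀ ≤ K → ∀ c ∈ Bad' K t, F K c * Rf K c ≤ famWeight (slotPrice (y K)) (str K c))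
    (hF' : ∀ K t, |t| ≤ l₀ → K₀ ≤ K → ∀ c ∈ Bad' K t, F' K c * Rf' K c ≤ famWeight (slotPrice (y K)) (str K c))
    (hC : 0 ≤ C) :
    ∃ K₁, K₀ ≤ K₁ ∧ RelWeightBound l₀ T A A' (fun K t => if K₁ ≤ K then badOfClass π T Bad' K t else ∅)
      (Set.indicator {K | K₁ ≤ K} (fun K => C * recordsBudget ρbar κ₁ V Λ ηbar jstar K)) := by
  obtain ⟨K₁, h01, h⟩ := exists_relWeightBound_of_recordsGasRun Cell hV hΛ hcell W step E B hE hκ ρ hρ hρbar η hη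
    hηbar hr jstar hj hc hfrac y hy0 hy str hinj hstr hA.globalDom hA'.globalDom hF hF' hC
  refine ⟨K₁, h01, ?_⟩
  rw [← badOfClass_ite_fun K₁]
  exact relWeightBound_of_classes h

end Run

/-! ## §3 End to end: typed flow + infrared smallness + labelled prices + regeneration runs ⇒ `RelWeightBound` -/

section EndToEnd

variable {γ κ ι : Type*} [DecidableEq γ] [DecidableEq κ] {l₀ : ℝ} {K₀ : ℕ} {π : ℕ → ι → κ} {T : ℕ → Finset ι}
  {A A' : ℕ → ℝ → ι → ℝ} {Bad' : ℕ → ℝ → Finset κ} {dead dead' : ℕ → ℝ → ι → ℝ} {F Rf F' Rf' : ℕ → κ → ℝ}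
  {nlow nup mlow mup : ℕ → ℝ → ℝ} {Cn : ℝ}

/-- **`Banking` ALONG A FAMILY OF RUNS + LABELLED PRICES + THE RECORDS GAS ⇒ THE WEIGHT SLOT.**  Constants `C` with
`0 ≤ κ₁`; a family of runs `(R K, g K)_K`; AT EVERY CUTOFF `K ≥ K₀` the printed shapes inhabit `Banking (Consistent C K
(R K)) (dictW (R K) C.n₁) (cost C K (R K)) (credit C (g K)) (κ₁·W + Emarg) (reserve C (g K)) (extn C K (R K))`; cells
`#Cell K a ≤ V·Λ^a`; event universes `E K j` on the steps `(j, K]` and birth kinds `B K j` with the model's residual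
budgets `Σ_{b ∈ B K j} rho C (g K) b ≤ ρ̄`, `Σ_{e ∈ E K j, step e = t} eta C e ≤ η̄`, rate `Λ·e^{η̄ − κ₁} < 1`; matching
scales `j⋆ K ≤ K` with `c·K ≤ K − j⋆ K`; prices `y K j z b Q ≥ 0`, LABELLED from `K₀` on by consistent well-formed
genealogies (the displayed (ID) binder); injective live families with an old slot; two term-level `Regeneration` runs
whose resummed live prices are dominated by `famWeight (slotPrice (y K))`; `0 ≤ Cn` ⇒ `∃ K₁ ≥ K₀`, the kernel's
term-level `RelWeightBound` with the saturated bad set and `W = 𝟙_{K ≥ K₁} · Cn · recordsBudget ρ̄ C.κ₁ V Λ η̄ j⋆`.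
§1 per cutoff, then §2. [folklore] -/
theorem exists_relWeightBound_of_banking {C : T4PrintedShapeBanking.Consts} (hκ : 0 ≤ C.κ₁) (R : ℕ → ℕ → ℕ) (g : ℕ → ℕ → ℝ)
    (hBk : ∀ K, K₀ ≤ K → Banking (Consistent C K (R K)) (dictW (R K) C.n₁) (cost C K (R K)) (credit C (g K))
      (fun e => C.κ₁ * ((dictW (R K) C.n₁ e : ℕ) : ℝ) + Emarg C e) (reserve C (g K)) (extn C K (R K)))
    (Cell : ℕ → ℕ → Finset γ) {V Λ : ℝ} (hV : 0 ≤ V) (hΛ : 0 < Λ)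
    (hcell : ∀ K a, ((Cell K a).card : ℝ) ≤ V * Λ ^ a) (E B : ℕ → ℕ → Finset PEv)
    (hE : ∀ K j, ∀ e ∈ E K j, PEv.step e ∈ Ioc j K) {ρbar ηbar : ℝ}
    (hρbar : ∀ K j, ∑ b ∈ B K j, rho C (g K) b ≤ ρbar)
    (hηbar : ∀ K j, ∀ t ∈ Ioc j K, ∑ e ∈ E K j with PEv.step e = t, eta C e ≤ ηbar)
    (hr : Λ * Real.exp (ηbar - C.κ₁) < 1) (jstar : ℕ → ℕ) (hj : ∀ K, jstar K ≤ K) {c : ℝ} (hc : 0 < c)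
    (hfrac : ∀ K : ℕ, c * K ≤ ((K - jstar K : ℕ) : ℝ)) (y : ℕ → ℕ → γ → PEv → Finset PEv → ℝ)
    (hy0 : ∀ K, ∀ j ≤ K, ∀ z ∈ Cell K (K - j), ∀ b ∈ B K j,
      ∀ Q ∈ records (dictW (R K) C.n₁) j K (E K j) b, 0 ≤ y K j z b Q)
    (hlab : ∀ K, K₀ ≤ K → ∀ j ≤ K, ∀ z ∈ Cell K (K - j), ∀ b ∈ B K j,
      ∀ Q ∈ records (dictW (R K) C.n₁) j K (E K j) b,
      y K j z b Q ≤ 0 ∨ ∃ G : Gen PEv, Consistent C K (R K) G ∧ G.WF (dictW (R K) C.n₁) ∧ G.root = b ∧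
        G.events.erase G.root = Q ∧
        y K j z b Q ≤ Real.exp (-credits (credit C (g K)) G) *
          Real.exp (lifeCost (dictW (R K) C.n₁) (cost C K (R K)) G))
    (str : ℕ → κ → Finset (Slot γ PEv))
    (hinj : ∀ K t, |t| ≤ l₀ → K₀ ≤ K → Set.InjOn (str K) (Bad' K t))
    (hstr : ∀ K t, |t| ≤ l₀ → K₀ ≤ K → ∀ c ∈ Bad' K t,
      str K c ⊆ liveSlots Cell (dictW (R K) C.n₁) E B K ∧
        ∃ o ∈ oldSlots Cell (dictW (R K) C.n₁) E B jstar K, o ∈ str K c)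
    (hA : Regeneration l₀ π T A Bad' dead F Rf nlow nup Cn K₀)
    (hA' : Regeneration l₀ π T A' Bad' dead' F' Rf' mlow mup Cn K₀)
    (hF : ∀ K t, |t| ≤ l₀ → K₀ ≤ K → ∀ c ∈ Bad' K t, F K c * Rf K c ≤ famWeight (slotPrice (y K)) (str K c))
    (hF' : ∀ K t, |t| ≤ l₀ → K₀ ≤ K → ∀ c ∈ Bad' K t, F' K c * Rf' K c ≤ famWeight (slotPrice (y K)) (str K c))
    (hCn : 0 ≤ Cn) :
    ∃ K₁, K₀ ≤ K₁ ∧ RelWeightBound l₀ T A A' (fun K t => if K₁ ≤ K then badOfClass π T Bad' K t else ∅)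
      (Set.indicator {K | K₁ ≤ K} (fun K => Cn * recordsBudget ρbar C.κ₁ V Λ ηbar jstar K)) :=
  exists_relWeightBound_of_regeneration_recordsGasRun Cell hV hΛ hcell (fun K => dictW (R K) C.n₁) PEv.step E B hE
    hκ (fun K => rho C (g K)) (fun K _ b _ => (rho_pos C (g K) b).le) hρbar (fun _ => eta C)
    (fun _ _ e _ => (eta_pos C e).le) hηbar hr jstar hj hc hfrac y hy0
    (fun K hK => recordShape_of_banking (hBk K hK) Cell E B (y K) (hlab K hK)) str hinj hstr hA hA' hF hF' hCn

/-- **END TO END — ONE INFRARED THRESHOLD, THEN THE WEIGHT SLOT.**  For valid symbolic constants with `a, A₀ > 0`,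
block size `L ≥ 1`, `β₀ ≥ 0` and the exponent condition `r(q′+1) < p₀` there is ONE number `x₀` (depending on these
only; `T4PrintedShapeBanking.exists_irThreshold`) such that: for EVERY family of runs `(R K, g K, β′ K)_K` obeying, from
the threshold `K₀` on, typed (2.7) `B14.FlowIneq27`, typed (2.9) `B14FlowStep.FlowIneq29`, typed (2.5) `B14.IsRj`,
`1 ≤ log g_{K,s}⁻²` (`s ≤ K`) and the INFRARED SMALLNESS `x₀ ≤ log g_{K,K}⁻²`, and for every remaining datum of
`exists_relWeightBound_of_banking` (cell geometry, residual budgets, matching scales, nonnegative LABELLED prices,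
injective live families with an old slot, two `Regeneration` runs dominated by the live-family record weights,
`0 ≤ Cn`), `∃ K₁ ≥ K₀` with the kernel's term-level `RelWeightBound`.  The count member's chain as ONE statement; its
binders are the census of what is not kernel. [folklore] -/
theorem exists_irThreshold_relWeightBound (C : T4PrintedShapeBanking.Consts) (hC : C.Valid) (ha : 0 < C.a) (hA₀ : 0 < C.A₀) {L r : ℕ}
    (hL : 1 ≤ L) {β₀ : ℝ} (hβ : 0 ≤ β₀) (hrq : r * (C.q' + 1) < C.p₀)
    (Cell : ℕ → ℕ → Finset γ) {V Λ : ℝ} (hV : 0 ≤ V) (hΛ : 0 < Λ)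
    (hcell : ∀ K a, ((Cell K a).card : ℝ) ≤ V * Λ ^ a) (E B : ℕ → ℕ → Finset PEv)
    (hE : ∀ K j, ∀ e ∈ E K j, PEv.step e ∈ Ioc j K) (jstar : ℕ → ℕ) (hj : ∀ K, jstar K ≤ K) {c : ℝ} (hc : 0 < c)
    (hfrac : ∀ K : ℕ, c * K ≤ ((K - jstar K : ℕ) : ℝ))
    (hA : Regeneration l₀ π T A Bad' dead F Rf nlow nup Cn K₀)
    (hA' : Regeneration l₀ π T A' Bad' dead' F' Rf' mlow mup Cn K₀) (hCn : 0 ≤ Cn) :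
    ∃ x₀ : ℝ, ∀ (R : ℕ → ℕ → ℕ) (g : ℕ → ℕ → ℝ) (β' : ℕ → ℝ),
      (∀ K, K₀ ≤ K → B14.FlowIneq27 (g K) (β' K) β₀ C.p₀ K) →
      (∀ K, K₀ ≤ K → B14FlowStep.FlowIneq29 (R K) (g K) L (β' K) β₀ K) →
      (∀ K, K₀ ≤ K → ∀ s, s ≤ K → B14.IsRj L r (g K s) (R K s)) →
      (∀ K, K₀ ≤ K → ∀ s, s ≤ K → 1 ≤ Real.log ((g K s) ^ 2)⁻¹) →
      (∀ K, K₀ ≤ K → x₀ ≤ Real.log ((g K K) ^ 2)⁻¹) →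
      ∀ {ρbar ηbar : ℝ}, (∀ K j, ∑ b ∈ B K j, rho C (g K) b ≤ ρbar) →
      (∀ K j, ∀ t ∈ Ioc j K, ∑ e ∈ E K j with PEv.step e = t, eta C e ≤ ηbar) →
      Λ * Real.exp (ηbar - C.κ₁) < 1 →
      ∀ (y : ℕ → ℕ → γ → PEv → Finset PEv → ℝ),
      (∀ K, ∀ j ≤ K, ∀ z ∈ Cell K (K - j), ∀ b ∈ B K j,
        ∀ Q ∈ records (dictW (R K) C.n₁) j K (E K j) b, 0 ≤ y K j z b Q) →
      (∀ K, K₀ ≤ K → ∀ j ≤ K, ∀ z ∈ Cell K (K - j), ∀ b ∈ B K j,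
        ∀ Q ∈ records (dictW (R K) C.n₁) j K (E K j) b,
        y K j z b Q ≤ 0 ∨ ∃ G : Gen PEv, Consistent C K (R K) G ∧ G.WF (dictW (R K) C.n₁) ∧ G.root = b ∧
          G.events.erase G.root = Q ∧
          y K j z b Q ≤ Real.exp (-credits (credit C (g K)) G) *
            Real.exp (lifeCost (dictW (R K) C.n₁) (cost C K (R K)) G)) →
      ∀ (str : ℕ → κ → Finset (Slot γ PEv)),
      (∀ K t, |t| ≤ l₀ → K₀ ≤ K → Set.InjOn (str K) (Bad' K t)) →
      (∀ K t, |t| ≤ l₀ → K₀ ≤ K → ∀ c ∈ Bad' K t,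
        str K c ⊆ liveSlots Cell (dictW (R K) C.n₁) E B K ∧
          ∃ o ∈ oldSlots Cell (dictW (R K) C.n₁) E B jstar K, o ∈ str K c) →
      (∀ K t, |t| ≤ l₀ → K₀ ≤ K → ∀ c ∈ Bad' K t, F K c * Rf K c ≤ famWeight (slotPrice (y K)) (str K c)) →
      (∀ K t, |t| ≤ l₀ → K₀ ≤ K → ∀ c ∈ Bad' K t, F' K c * Rf' K c ≤ famWeight (slotPrice (y K)) (str K c)) →
      ∃ K₁, K₀ ≤ K₁ ∧ RelWeightBound l₀ T A A' (fun K t => if K₁ ≤ K then badOfClass π T Bad' K t else ∅)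
        (Set.indicator {K | K₁ ≤ K} (fun K => Cn * recordsBudget ρbar C.κ₁ V Λ ηbar jstar K)) := by
  obtain ⟨x₀, hx₀⟩ := exists_irThreshold C hC ha hA₀ hL hβ hrq
  refine ⟨x₀, ?_⟩
  intro R g β' h27 h29 hR hx1 hir ρbar ηbar hρbar hηbar hr y hy0 hlab str hinj hstr hF hF'
  exact exists_relWeightBound_of_banking hC.κ₁_nonneg R g
    (fun K hK => hx₀ K (R K) (g K) (β' K) (h27 K hK) (h29 K hK) (hR K hK) (hx1 K hK) (hir K hK))
    Cell hV hΛ hcell E B hE hρbar hηbar hr jstar hj hc hfrac y hy0 hlab str hinj hstr hA hA' hF hF' hCn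

end EndToEnd

/-! ## §4 Sanity: the labelling data are inhabited; `rho` / `eta` on the three kinds -/

section Sanity

open XreadC4

/-- The cross-read's bare birth `X₀ = born (0,0,0) 0` is consistent and well-formed at the constants `C₀`, cutoff `10`,
windows `R ≡ 2`, with root `(0,0,0)` and EMPTY record — the labelling data of §1 are inhabited (decided). [folklore] -/
example : Consistent C₀ 10 (fun _ => 2) X₀ ∧ X₀.WF (dictW (fun _ => 2) C₀.n₁) ∧ X₀.root = ((0, 0, 0) : PEv) ∧
    X₀.events.erase X₀.root = ∅ := by
  refine ⟨?_, ?_, rfl, ?_⟩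
  · simp [Consistent, X₀, PEv.kind, PEv.step]
  · simp [Gen.WF, X₀]
  · simp [X₀]

/-- … and the cross-read's MERGED history `Z₀ = merge X₀ Y₀ (3,2,0)` (consistent and well-formed by
`T4PrintedShapeBanking.XreadC4.Z₀_consistent` / `Z₀_wf`) has root `(0,0,0)` and record `{(2,0,0), (3,2,0)}`: a two-event
record of the count labelled by a genealogy with a merger (decided). [folklore] -/
example : Consistent C₀ 10 (fun _ => 2) Z₀ ∧ Z₀.WF (dictW (fun _ => 2) C₀.n₁) ∧ Z₀.root = ((0, 0, 0) : PEv) ∧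
    Z₀.events.erase Z₀.root = {((3, 2, 0) : PEv), ((2, 0, 0) : PEv)} := by
  refine ⟨Z₀_consistent, Z₀_wf, ?_, ?_⟩
  · decide
  · decide

/-- With the raw factor itself as the price, the labelled branch of §1 holds for `Z₀` (reflexively) — so `price_le_shape`
is not vacuous on merged histories. [folklore] -/
example (g : ℕ → ℝ) :
    (Real.exp (-credits (credit C₀ g) Z₀) * Real.exp (lifeCost (dictW (fun _ => 2) C₀.n₁) (cost C₀ 10 (fun _ => 2)) Z₀)
        ≤ 0) ∨
      ∃ G : Gen PEv, Consistent C₀ 10 (fun _ => 2) G ∧ G.WF (dictW (fun _ => 2) C₀.n₁) ∧ G.root = ((0, 0, 0) : PEv) ∧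
        G.events.erase G.root = {((3, 2, 0) : PEv), ((2, 0, 0) : PEv)} ∧
        Real.exp (-credits (credit C₀ g) Z₀) *
            Real.exp (lifeCost (dictW (fun _ => 2) C₀.n₁) (cost C₀ 10 (fun _ => 2)) Z₀) ≤
          Real.exp (-credits (credit C₀ g) G) * Real.exp (lifeCost (dictW (fun _ => 2) C₀.n₁) (cost C₀ 10 (fun _ => 2)) G) :=
  Or.inr ⟨Z₀, Z₀_consistent, Z₀_wf, by decide, by decide, le_rfl⟩

/-- `rho` at a birth of class `d′` at step `s`: `e^{−(2p₀(g_s) + Eb + μ(d′+1))}` — the birth price of the count.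
[folklore] -/
theorem rho_birth (C : T4PrintedShapeBanking.Consts) (g : ℕ → ℝ) (s d : ℕ) :
    rho C g ((s, 0, d) : PEv) = Real.exp (-(2 * p0Profile C.A₀ C.p₀ (g s) + (C.Eb + C.μ * ((d : ℝ) + 1)))) := by
  rw [rho_eq, reserve_kind0 (by rfl), Emarg_kind0 (by rfl)]
  simp [PEv.step, PEv.fat]

/-- `eta` at a renewal: `e^{−E₀}`, whatever the (dummy) fatness coordinate. [folklore] -/
theorem eta_renew (C : T4PrintedShapeBanking.Consts) (s d : ℕ) : eta C ((s, 1, d) : PEv) = Real.exp (-C.E₀) := by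
  rw [eta_eq, Emarg_kind1 (by rfl)]

/-- `eta` at a merger: `e^{−E₀}`, whatever the (dummy) fatness coordinate — see the REMARK on the event universe in the
module docstring. [folklore] -/
theorem eta_merge (C : T4PrintedShapeBanking.Consts) (s d : ℕ) : eta C ((s, 2, d) : PEv) = Real.exp (-C.E₀) := by
  rw [eta_eq, Emarg_kind2 (by rfl)]

/-- `eta` at a birth of class `d′` (a NEW region joining at a merger, reading m1): `e^{−(Eb + μ(d′+1))}`. [folklore] -/
theorem eta_birth (C : T4PrintedShapeBanking.Consts) (s d : ℕ) :
    eta C ((s, 0, d) : PEv) = Real.exp (-(C.Eb + C.μ * ((d : ℝ) + 1))) := by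
  rw [eta_eq, Emarg_kind0 (by rfl)]
  simp [PEv.fat]

end Sanity

end Literature.MathematicalPhysics.QuantumFieldTheory.Balaban1983to89.T4RecordPriceSeam
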